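import Summits.CriticalPhenomena.Ising3DConformalLimit.Theses.PrecisionLaplacian
import Literature.Probability.LatticeModels.CriticalTwoPointLawDimension
import Literature.Barriers.CriticalPhenomena.TwoPointLawNotMoebius

/-!
# `MoebiusLimitOfTwoPointLaw` (crux `stmt-CriticalPhenomena-4801`, routes `PrecisionLaplacian` /
# `BernsteinTemperature`): read-back (negative-side support)

Support file of the crux disprover (cdisprove seat, cycle 2). The crux is `P → Q` with `P` = item 0634 (the
isotropic pure power law `⟨σ₀σ_x⟩_{β_c}‖x‖₂^{2Δ} → c > 0` on `ℤ³`) and `Q` = item 1344 (a non-degenerate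
Möbius-covariant pointwise scaling limit `(ρ, Δ', S)` of `criticalCorr 3`). Proved here, `sorry`-free:

* `not_moebiusLimitOfTwoPointLaw_iff` — the exact shape of a refutation: `¬crux ↔ P ∧ ¬Q`; with
  `not_conjunct_of_not_moebiusLimitOfTwoPointLaw`, a kill would refute the summit conjunct `Ising3DConformalLimit`
  (so the crux is unkillable short of proving item 0634 AND refuting the conjunct).
* `moebiusLimitOfTwoPointLaw_iff_of_dropPosC` — `0 < c` is load-bearing: dropping it from `P` collapses the crux
  to item 1344 (the weakened hypothesis is a theorem: `⟨σ₀σ_x⟩_{β_c} → 0`, `criticalTwoPoint_tendsto_zero_cofinite`).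
* `twoPointLaw_exponent_gt_half_of_nonSaturation` — `P` + non-saturation of the infrared bound (the shape of
  item 1342 `PerfectScreening.NonSaturation`) force `1/2 < Δ` (glue B1 of crux card
  `multipole-ward-nonsat-endpoint`, `Cruxes/MoebiusLimitOfTwoPointLaw/SketchIdeator2R1.lean`, proved).

What `P` pins otherwise is in `Literature/Probability/LatticeModels/CriticalTwoPointLawDimension.lean`
(`Δ' = Δ ∈ [1/2,1]`, `ρ` forced along dyadic meshes); the canonical form of the crux is in `CanonicalForm.lean`
(this directory); the model-blind strengthening is refuted in
`Literature/Barriers/CriticalPhenomena/TwoPointLawNotMoebius.lean`.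
-/

noncomputable section

namespace Summit.CriticalPhenomena.Ising3DConformalLimit.Theorems.MoebiusLimitOfTwoPointLaw.Negative

open Literature.Probability.LatticeModels Filter Topology
open Summit.CriticalPhenomena.Ising3DConformalLimit.Theses.PrecisionLaplacian (MoebiusLimitOfTwoPointLaw)

/-! ## §1 Read-back -/

/-- **What a kill costs.** `¬crux ↔ P ∧ ¬Q`: a refutation must PROVE item 0634 and REFUTE item 1344 (hence,
by `not_conjunct_of_not_moebiusLimitOfTwoPointLaw`, the conjunct `Ising3DConformalLimit`). -/
theorem not_moebiusLimitOfTwoPointLaw_iff :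
    ¬ MoebiusLimitOfTwoPointLaw ↔
      ((∃ Δ c : ℝ, 0 < c ∧ Tendsto (fun x : Site 3 =>
          criticalTwoPoint 3 x * Real.sqrt (∑ i, ((x i : ℝ)) ^ 2) ^ (2 * Δ)) cofinite (nhds c)) ∧
        ¬ ∃ (ρ : ℝ → ℝ) (Δ : ℝ) (S : CorrFamily 3), (∀ δ ∈ Set.Ioc (0:ℝ) 1, 0 < ρ δ) ∧ 0 < Δ ∧
          HasPointwiseScalingLimit (criticalCorr 3) ρ S ∧ IsNondegenerateTwoPoint S ∧
          IsMoebiusCovariant Δ S) := by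
  unfold MoebiusLimitOfTwoPointLaw; push Not; rfl

/-- A kill refutes the summit conjunct (which implies item 1344: drop clause (iii)). -/
theorem not_conjunct_of_not_moebiusLimitOfTwoPointLaw (h : ¬ MoebiusLimitOfTwoPointLaw) :
    ¬ CritIsing3DConformalLimit := by
  rintro ⟨ρ, Δ, S, hρ, hΔ, hlim, hnd, hM, -⟩
  exact h fun _ => ⟨ρ, Δ, S, hρ, hΔ, hlim, hnd, hM⟩

/-- **`0 < c` is load-bearing.** With `0 < c` dropped, the hypothesis of the crux is a THEOREM of the tree
(`Δ = 0`, `c = 0`: `⟨σ₀σ_x⟩_{β_c} → 0`), so the weakened crux is EQUIVALENT to item 1344 itself. -/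
theorem moebiusLimitOfTwoPointLaw_iff_of_dropPosC :
    ((∃ Δ c : ℝ, Tendsto (fun x : Site 3 =>
        criticalTwoPoint 3 x * Real.sqrt (∑ i, ((x i : ℝ)) ^ 2) ^ (2 * Δ)) cofinite (nhds c)) →
      ∃ (ρ : ℝ → ℝ) (Δ : ℝ) (S : CorrFamily 3), (∀ δ ∈ Set.Ioc (0:ℝ) 1, 0 < ρ δ) ∧ 0 < Δ ∧
        HasPointwiseScalingLimit (criticalCorr 3) ρ S ∧ IsNondegenerateTwoPoint S ∧ IsMoebiusCovariant Δ S) ↔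
    ∃ (ρ : ℝ → ℝ) (Δ : ℝ) (S : CorrFamily 3), (∀ δ ∈ Set.Ioc (0:ℝ) 1, 0 < ρ δ) ∧ 0 < Δ ∧
        HasPointwiseScalingLimit (criticalCorr 3) ρ S ∧ IsNondegenerateTwoPoint S ∧ IsMoebiusCovariant Δ S := by
  have hweak : ∃ Δ c : ℝ, Tendsto (fun x : Site 3 =>
      criticalTwoPoint 3 x * Real.sqrt (∑ i, ((x i : ℝ)) ^ 2) ^ (2 * Δ)) cofinite (nhds c) := by
    refine ⟨0, 0, criticalTwoPoint_tendsto_zero_cofinite.congr fun x => ?_⟩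
    simp
  exact ⟨fun h => h hweak, fun h _ => h⟩

/-! ## §3 `P` plus non-saturation of the infrared bound pins `Δ > 1/2` (glue B1 of card
`multipole-ward-nonsat-endpoint`, `Cruxes/MoebiusLimitOfTwoPointLaw/SketchIdeator2R1.lean`, proved) -/

/-- If the infrared bound is not saturated along the first axis (`liminf n·⟨σ₀σ_{ne₁}⟩_{β_c} = 0`, the shape of
item 1342 `PerfectScreening.NonSaturation`) then every witness `(Δ, c)` of the two-point law has `1/2 < Δ`:
otherwise `n·G(ne₁) = (G(ne₁)n^{2Δ})·n^{1−2Δ} ≥ c/2` eventually. (With `twoPointLaw_exponent_mem_Icc`: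
`Δ ∈ (1/2, 1]`.) -/
theorem twoPointLaw_exponent_gt_half_of_nonSaturation
    (hNS : ∀ ε : ℝ, 0 < ε → ∃ᶠ n : ℕ in atTop, (n : ℝ) * criticalTwoPoint 3 (Pi.single 0 (n : ℤ)) < ε)
    {Δ c : ℝ} (hc : 0 < c)
    (hP : Tendsto (fun x : Site 3 =>
      criticalTwoPoint 3 x * Real.sqrt (∑ i, ((x i : ℝ)) ^ 2) ^ (2 * Δ)) cofinite (nhds c)) :
    1 / 2 < Δ := by
  by_contra hle
  push Not at hle
  have hseq : Tendsto (fun n : ℕ => criticalTwoPoint 3 (Pi.single 0 (n : ℤ)) * (n : ℝ) ^ (2 * Δ))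
      atTop (nhds c) := by
    refine (hP.comp tendsto_natCast_single_axis_cofinite).congr fun n => ?_
    simp only [Function.comp_apply]
    rw [sqrt_sum_sq_single_axis, Int.cast_natCast, abs_of_nonneg (Nat.cast_nonneg n)]
  have hev : ∀ᶠ n : ℕ in atTop, c / 2 ≤ (n : ℝ) * criticalTwoPoint 3 (Pi.single 0 (n : ℤ)) := by
    have h1 : ∀ᶠ n : ℕ in atTop, c / 2 < criticalTwoPoint 3 (Pi.single 0 (n : ℤ)) * (n : ℝ) ^ (2 * Δ) :=
      hseq.eventually (lt_mem_nhds (by linarith))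
    have h2 : ∀ᶠ n : ℕ in atTop, 1 ≤ n := eventually_ge_atTop 1
    filter_upwards [h1, h2] with n hn hn1
    have hnpos : (0 : ℝ) < n := by exact_mod_cast hn1
    have hone : (1 : ℝ) ≤ (n : ℝ) ^ (1 - 2 * Δ) :=
      Real.one_le_rpow (by exact_mod_cast hn1) (by linarith)
    have hsplit : (n : ℝ) * criticalTwoPoint 3 (Pi.single 0 (n : ℤ)) =
        (criticalTwoPoint 3 (Pi.single 0 (n : ℤ)) * (n : ℝ) ^ (2 * Δ)) * (n : ℝ) ^ (1 - 2 * Δ) := by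
      rw [mul_assoc, ← Real.rpow_add hnpos, show 2 * Δ + (1 - 2 * Δ) = (1 : ℝ) by ring, Real.rpow_one,
        mul_comm]
    rw [hsplit]
    calc c / 2 = c / 2 * 1 := (mul_one _).symm
      _ ≤ (criticalTwoPoint 3 (Pi.single 0 (n : ℤ)) * (n : ℝ) ^ (2 * Δ)) * (n : ℝ) ^ (1 - 2 * Δ) :=
          mul_le_mul hn.le hone zero_le_one (by linarith)
  obtain ⟨n, hn1, hn2⟩ := ((hNS (c / 2) (by linarith)).and_eventually hev).exists
  linarith

end Summit.CriticalPhenomena.Ising3DConformalLimit.Theorems.MoebiusLimitOfTwoPointLaw.Negative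

end
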